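import Literature.Geometry.ComplexAnalytic.PhamBrieskornA3InvolutionRanks
import Literature.AlgebraicTopology.SingularHomology.FreeActionLefschetzNumber
import HarnessLib

/-!
# The local piece `F°∕ι` of the d6 degeneration: the punctured Milnor fibre `F° = F ∖ Fix(ι)` of `z₀² + z₁² + z₂^p`, its FREE
# involution `ι`, the orbit space `F°∕ι`, and `H²(F°∕ι; ℚ)` = the `ι`-invariant classes (Hatcher Prop. 3G.1); for `p = 4`:
# rank `2`, `τ̄^*² = −1`, and the descended model monodromy acts as `τ̄^*` — modulo the puncture isomorphism `H²(F) ≅ H²(F°)`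

Family `hodge`, layer `Literature/Geometry/ComplexAnalytic`; sequel of `PhamBrieskornA3Involution*` (the involution
`ι : (z₀, z₁, z₂) ↦ (−z₀, z₁, −z₂)`, its fixed points `z₀ = z₂ = 0`, `ι^* = −(τ^*)²`, `dim_ℚ ker((τ^*)² + 1) = 2`) and of the tree's
orbit-space transfer (`Literature.AlgebraicTopology.SingularHomology.OrbitSpace`: `M → M∕⟨t⟩` for a free homeomorphism of prime order is a
regular covering; `q^*` is injective with image the invariants, Hatcher §3.G Prop. 3G.1). Written by the prover seat
`hodge-nonav-prover-Ax` (g18) as brick L6-5a of the LOC6 plan for crux K1Q `VeryGeneralQuaternionCommutatorsInHg`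
(route `Summits/HodgeConjecture/HodgeConjecture/Theses/Q8SymplecticPowers.lean`, stub S5; memo `memos/LOC6-ARCHITECTURE-Ax-g18.md` §3 (U)):
in the complement `U_s = X_s ∖ ⋃E` of the exceptional curves the member of the quaternionic quartic family meets the ball at a d6
point in `F°∕ι` (memo ROUTE-P3v27 (C22): member `= Z∕ι`, `Z` the `A₃` smoothing, `ι` free off the two `A₁` points).

* §1 `punct p` (`F°`), open, non-empty, locally compact; the restrictions `iotaPunct`, `rotatePunct`, `negPairPunct`; `ι` is a FREE
  involution of `F°` commuting with the covering rotations and the model monodromy.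
* §2 the orbit space `OrbitSpace (iotaPunct …)`: **`map_proj_injective_rat`**, **`mem_range_map_proj_iff_rat`** (image of `q^*` = the
  `ι^*`-invariant classes), `map_proj_map_orbitMap` (`q^* ∘ s̄^* = s^* ∘ q^*` for the descended homeomorphisms `OrbitSpace.map s`).
* §3 **`quotientPiece_package`** (`p = 4`, GIVEN the puncture isomorphism `H²(F; ℚ) ≅ H²(F°; ℚ)` along the inclusion — brick L6-5b):
  `dim_ℚ H²(F°∕ι; ℚ) = 2`, `(τ̄^*)² = −1`, and the descended model monodromy acts as `τ̄^*`.
No HC content; no named fact; rung F-H1 not moved.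

## References
* [HatcherAT2002] A. Hatcher, Algebraic Topology, CUP 2002, §1.3 Prop. 1.40, §3.G Prop. 3G.1.
* [CarlsonToledo1999] J. A. Carlson, D. Toledo, Duke Math. J. 97 (1999), §6 (held text p0013–p0014).
* [Milnor1968] J. Milnor, Singular Points of Complex Hypersurfaces, §9 Thm. 9.1.
-/

noncomputable section

open Complex ContinuousMap Set CategoryTheory
open Literature.AlgebraicTopology.SingularHomology

namespace Literature.Geometry.ComplexAnalytic

namespace PhamBrieskorn

/-! ### §1 The punctured fibre `F°` and its free involution -/

section Punct

variable (p : ℕ)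

/-- **The punctured Milnor fibre `F° = F ∖ Fix(ι)`**: the points of `F = {z₀² + z₁² + z₂^p = 1}` with `z₀ ≠ 0` or `z₂ ≠ 0` (the complement
of the two fixed points `(0, ±1, 0)` of `ι`). [cite: CarlsonToledo1999, §6 (held text p0013–p0014)] -/
def punct : Set (fibre (cyclicNodeExponents p)) :=
  {z | (z : Fin (1 + 2) → ℂ) 0 ≠ 0 ∨ (z : Fin (1 + 2) → ℂ) (Fin.last 2) ≠ 0}

/-- Membership in `F°`. [cite: CarlsonToledo1999, §6 (held text p0013–p0014)] -/
theorem mem_punct_iff (z : fibre (cyclicNodeExponents p)) :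
    z ∈ punct p ↔ (z : Fin (1 + 2) → ℂ) 0 ≠ 0 ∨ (z : Fin (1 + 2) → ℂ) (Fin.last 2) ≠ 0 := Iff.rfl

/-- `F°` is open in `F`. [cite: CarlsonToledo1999, §6 (held text p0013–p0014)] -/
theorem isOpen_punct : IsOpen (punct p) := by
  have h0 : Continuous fun z : fibre (cyclicNodeExponents p) => (z : Fin (1 + 2) → ℂ) 0 :=
    (continuous_apply 0).comp continuous_subtype_val
  have h2 : Continuous fun z : fibre (cyclicNodeExponents p) => (z : Fin (1 + 2) → ℂ) (Fin.last 2) :=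
    (continuous_apply (Fin.last 2)).comp continuous_subtype_val
  exact (isOpen_compl_singleton.preimage h0).union (isOpen_compl_singleton.preimage h2)

/-- `F°` is exactly the complement of the fixed-point set of `ι` (`p` even). [cite: CarlsonToledo1999, §6 (held text p0013–p0014)] -/
theorem mem_punct_iff_iotaFibre_ne (hp : p ≠ 0) (hpe : Even p) (z : fibre (cyclicNodeExponents p)) :
    z ∈ punct p ↔ iotaFibre p hp hpe z ≠ z := by
  rw [mem_punct_iff, Ne, Ne, Ne, iotaFibre_eq_self_iff, not_and_or]

/-- `(1, 0, 0) ∈ F°`: the punctured fibre is non-empty. [cite: Milnor1968, §9 Thm. 9.1] -/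
theorem punct_nonempty (hp : p ≠ 0) : (punct p).Nonempty := by
  have hmem : (fun i : Fin (1 + 2) => if i = 0 then (1 : ℂ) else 0) ∈ fibre (cyclicNodeExponents p) := by
    rw [mem_fibre, Fin.sum_univ_three]
    have h1 : ((1 : Fin (1 + 2)) = 0) = False := by decide
    have h2 : ((2 : Fin (1 + 2)) = 0) = False := by decide
    simp only [if_true, h1, h2, if_false, one_pow]
    rw [zero_pow (cyclicNodeExponents_ne_zero p hp 1), zero_pow (cyclicNodeExponents_ne_zero p hp 2), add_zero, add_zero]
  exact ⟨⟨_, hmem⟩, Or.inl (by simp)⟩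

/-- `F°` is locally compact (open in `F`, which is closed in `ℂ³`). [cite: Milnor1968, §9 Thm. 9.1] -/
theorem locallyCompactSpace_punct : LocallyCompactSpace ↥(punct p) := by
  haveI : LocallyCompactSpace (fibre (cyclicNodeExponents p)) := (isClosed_fibre (a := cyclicNodeExponents p)).locallyCompactSpace
  exact (isOpen_punct p).locallyCompactSpace

variable (hp : p ≠ 0) (hpe : Even p)

/-- `ι` preserves `F°`. [cite: CarlsonToledo1999, §6 (held text p0013–p0014)] -/
theorem mem_punct_iff_iotaFibre_mem (z : fibre (cyclicNodeExponents p)) : z ∈ punct p ↔ iotaFibre p hp hpe z ∈ punct p := by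
  rw [mem_punct_iff, mem_punct_iff, iotaFibre_apply_zero, iotaFibre_apply_last, neg_ne_zero, neg_ne_zero]

/-- **The free involution `ι` of `F°`** (restriction of `iotaFibre`). [cite: CarlsonToledo1999, §6 (held text p0013–p0014)] -/
def iotaPunct : ↥(punct p) ≃ₜ ↥(punct p) := (iotaFibre p hp hpe).subtype (mem_punct_iff_iotaFibre_mem p hp hpe)

/-- `iotaPunct` on points. [cite: CarlsonToledo1999, §6 (held text p0013–p0014)] -/
@[simp] theorem iotaPunct_apply_coe (z : ↥(punct p)) : ((iotaPunct p hp hpe z : ↥(punct p)) : fibre (cyclicNodeExponents p)) =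
    iotaFibre p hp hpe z := rfl

/-- `ι² = 1` on `F°`. [cite: CarlsonToledo1999, §6 (held text p0013–p0014)] -/
theorem iotaPunct_sq : iotaPunct p hp hpe ^ 2 = 1 := by
  refine Homeomorph.ext fun z => Subtype.ext ?_
  rw [pow_two, Homeomorph.mul_apply, Homeomorph.one_apply, iotaPunct_apply_coe, iotaPunct_apply_coe, iotaFibre_iotaFibre]

/-- **`ι` acts freely on `F°`** (in the form used by `OrbitSpace`: no power `ιⁱ`, `0 < i < 2`, has a fixed point).
[cite: CarlsonToledo1999, §6 (held text p0013–p0014)] -/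
theorem iotaPunct_free : ∀ i : ℕ, 0 < i → i < 2 → ∀ z : ↥(punct p), (iotaPunct p hp hpe ^ i) z ≠ z := by
  intro i hi hi2 z h
  obtain rfl : i = 1 := by omega
  rw [pow_one] at h
  have h' : iotaFibre p hp hpe z = z := by
    have := congrArg (fun w : ↥(punct p) => (w : fibre (cyclicNodeExponents p))) h
    simpa using this
  exact (mem_punct_iff_iotaFibre_ne p hp hpe z).1 z.2 h'

/-- The covering rotation `σ_v` preserves `F°`. [cite: CarlsonToledo1999, §6 (held text p0013–p0014)] -/
theorem mem_punct_iff_rotateFibre_mem (v : Omega (cyclicNodeExponents p (Fin.last 2))) (z : fibre (cyclicNodeExponents p)) :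
    z ∈ punct p ↔ rotateFibre (cyclicNodeExponents p) (cyclicNodeExponents_ne_zero p hp) v z ∈ punct p := by
  have hv0 : (v : ℂ) ≠ 0 := ne_zero_of_mem_Omega (cyclicNodeExponents_ne_zero p hp _) v.2
  have h0 : ((0 : Fin 2).castSucc : Fin (1 + 2)) = 0 := rfl
  rw [mem_punct_iff, mem_punct_iff, rotateFibre_apply_coe, rotateFun_last, ← h0, rotateFun_castSucc, mul_ne_zero_iff]
  exact ⟨fun h => h.imp id fun h2 => ⟨hv0, h2⟩, fun h => h.imp id fun h2 => h2.2⟩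

/-- The covering rotation `σ_v` restricted to `F°`. [cite: CarlsonToledo1999, §6 (held text p0013–p0014)] -/
def rotatePunct (v : Omega (cyclicNodeExponents p (Fin.last 2))) : ↥(punct p) ≃ₜ ↥(punct p) :=
  (rotateFibre (cyclicNodeExponents p) (cyclicNodeExponents_ne_zero p hp) v).subtype (mem_punct_iff_rotateFibre_mem p hp v)

/-- `rotatePunct` on points. [cite: CarlsonToledo1999, §6 (held text p0013–p0014)] -/
@[simp] theorem rotatePunct_apply_coe (v : Omega (cyclicNodeExponents p (Fin.last 2))) (z : ↥(punct p)) :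
    ((rotatePunct p hp v z : ↥(punct p)) : fibre (cyclicNodeExponents p)) =
      rotateFibre (cyclicNodeExponents p) (cyclicNodeExponents_ne_zero p hp) v z := rfl

/-- The sign change of the quadratic pair preserves `F°`. [cite: CarlsonToledo1999, §6 (held text p0013)] -/
theorem mem_punct_iff_negPairFibre_mem (z : fibre (cyclicNodeExponents p)) :
    z ∈ punct p ↔ negPairFibre (cyclicNodeExponents p) (i := 0) (j := 1) (by decide) rfl rfl z ∈ punct p := by
  obtain ⟨h0, -, h2⟩ := negPairFibre_cyclicNode_apply p z
  rw [mem_punct_iff, mem_punct_iff, h0, h2, neg_ne_zero]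

/-- The sign change of the quadratic pair restricted to `F°`. [cite: CarlsonToledo1999, §6 (held text p0013)] -/
def negPairPunct : ↥(punct p) ≃ₜ ↥(punct p) :=
  (negPairFibre (cyclicNodeExponents p) (i := 0) (j := 1) (by decide) rfl rfl).subtype (mem_punct_iff_negPairFibre_mem p)

/-- `negPairPunct` on points. [cite: CarlsonToledo1999, §6 (held text p0013)] -/
@[simp] theorem negPairPunct_apply_coe (z : ↥(punct p)) :
    ((negPairPunct p z : ↥(punct p)) : fibre (cyclicNodeExponents p)) =
      negPairFibre (cyclicNodeExponents p) (i := 0) (j := 1) (by decide) rfl rfl z := rfl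

/-- `σ_v` commutes with `ι` on `F°`. [cite: CarlsonToledo1999, §6 (held text p0013–p0014)] -/
theorem commute_rotatePunct_iotaPunct (v : Omega (cyclicNodeExponents p (Fin.last 2))) :
    Commute (rotatePunct p hp v) (iotaPunct p hp hpe) := by
  refine Homeomorph.ext fun z => Subtype.ext ?_
  change ((rotatePunct p hp v (iotaPunct p hp hpe z) : ↥(punct p)) : fibre (cyclicNodeExponents p)) =
    ((iotaPunct p hp hpe (rotatePunct p hp v z) : ↥(punct p)) : fibre (cyclicNodeExponents p))
  rw [rotatePunct_apply_coe, iotaPunct_apply_coe, iotaPunct_apply_coe, rotatePunct_apply_coe]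
  exact (congrArg (fun f : C(fibre (cyclicNodeExponents p), fibre (cyclicNodeExponents p)) => f (z : fibre (cyclicNodeExponents p)))
    (iotaFibre_comp_rotateFibre p hp hpe v)).symm

/-- The sign change of the quadratic pair commutes with `ι` on `F°`. [cite: CarlsonToledo1999, §6 (held text p0013–p0014)] -/
theorem commute_negPairPunct_iotaPunct : Commute (negPairPunct p) (iotaPunct p hp hpe) := by
  refine Homeomorph.ext fun z => Subtype.ext ?_
  change ((negPairPunct p (iotaPunct p hp hpe z) : ↥(punct p)) : fibre (cyclicNodeExponents p)) =
    ((iotaPunct p hp hpe (negPairPunct p z) : ↥(punct p)) : fibre (cyclicNodeExponents p))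
  rw [negPairPunct_apply_coe, iotaPunct_apply_coe, iotaPunct_apply_coe, negPairPunct_apply_coe]
  exact (congrArg (fun f : C(fibre (cyclicNodeExponents p), fibre (cyclicNodeExponents p)) => f (z : fibre (cyclicNodeExponents p)))
    (iotaFibre_comp_negPairFibre p hp hpe)).symm

/-- The model monodromy `negPair ∘ σ_v` commutes with `ι` on `F°`. [cite: CarlsonToledo1999, §6 (kdoublept) (held text p0013–p0014)] -/
theorem commute_modelPunct_iotaPunct (v : Omega (cyclicNodeExponents p (Fin.last 2))) :
    Commute (negPairPunct p * rotatePunct p hp v) (iotaPunct p hp hpe) :=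
  (commute_negPairPunct_iotaPunct p hp hpe).mul_left (commute_rotatePunct_iotaPunct p hp hpe v)

end Punct

/-! ### §2 The orbit space `F°∕ι` and the transfer over `ℚ` -/

section Quotient

variable (p : ℕ) (hp : p ≠ 0) (hpe : Even p)

attribute [local instance] OrbitSpace.homeoMulAction

/-- **`q^* : H^k(F°∕ι; ℚ) → H^k(F°; ℚ)` is injective** (the orbit map of the free involution `ι` is a two-sheeted regular covering;
transfer with `2` invertible in `ℚ`). [cite: HatcherAT2002, §3.G Prop. 3G.1] -/
theorem map_proj_injective_rat (k : ℕ) :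
    Function.Injective (singularCohomology.map ℚ ℚ (OrbitSpace.proj (iotaPunct p hp hpe)) k) := by
  haveI : Nonempty ↥(punct p) := (punct_nonempty p hp).to_subtype
  haveI := locallyCompactSpace_punct p
  letI := OrbitSpace.zpowersFintype (iotaPunct p hp hpe) (iotaPunct_sq p hp hpe)
  have hG : (Fintype.card (Subgroup.zpowers (iotaPunct p hp hpe)) : ℚ) ≠ 0 := by
    rw [OrbitSpace.card_zpowers (iotaPunct p hp hpe) (iotaPunct_sq p hp hpe) (iotaPunct_free p hp hpe)]; norm_num
  exact (OrbitSpace.deckCover (iotaPunct p hp hpe) (iotaPunct_sq p hp hpe) (iotaPunct_free p hp hpe)).map_proj_injective_of_card_ne_zero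
    ℚ hG k

/-- **The image of `q^*` is the `ι^*`-invariant classes**: `y ∈ q^* H^k(F°∕ι; ℚ)` iff `ι^* y = y`. [cite: HatcherAT2002, §3.G Prop. 3G.1] -/
theorem mem_range_map_proj_iff_rat (k : ℕ) (y : singularCohomology ℚ ℚ ↥(punct p) k) :
    y ∈ Set.range (singularCohomology.map ℚ ℚ (OrbitSpace.proj (iotaPunct p hp hpe)) k) ↔
      singularCohomology.map ℚ ℚ (iotaPunct p hp hpe : C(↥(punct p), ↥(punct p))) k y = y := by
  haveI : Nonempty ↥(punct p) := (punct_nonempty p hp).to_subtype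
  haveI := locallyCompactSpace_punct p
  letI := OrbitSpace.zpowersFintype (iotaPunct p hp hpe) (iotaPunct_sq p hp hpe)
  have hG : (Fintype.card (Subgroup.zpowers (iotaPunct p hp hpe)) : ℚ) ≠ 0 := by
    rw [OrbitSpace.card_zpowers (iotaPunct p hp hpe) (iotaPunct_sq p hp hpe) (iotaPunct_free p hp hpe)]; norm_num
  have h1 := (OrbitSpace.deckCover (iotaPunct p hp hpe) (iotaPunct_sq p hp hpe) (iotaPunct_free p hp hpe)).mem_range_map_proj_iff ℚ hG k y
  change (y ∈ Set.range (singularCohomology.map ℚ ℚ (OrbitSpace.proj (iotaPunct p hp hpe)) k) ↔ _) at h1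
  rw [h1]
  constructor
  · intro h
    exact h ⟨iotaPunct p hp hpe, Subgroup.mem_zpowers _⟩
  · intro h g
    obtain ⟨i, -, hg⟩ := OrbitSpace.exists_coe_eq_pow (iotaPunct p hp hpe) (iotaPunct_sq p hp hpe) g
    rw [OrbitSpace.deckCover_deck, hg]
    clear hg
    induction i with
    | zero =>
      have hcoe : ((iotaPunct p hp hpe ^ 0 : ↥(punct p) ≃ₜ ↥(punct p)) : C(↥(punct p), ↥(punct p))) = ContinuousMap.id _ := by
        ext x; rw [pow_zero]; rfl
      rw [hcoe, singularCohomology.map_id]; rfl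
    | succ i ih =>
      have hcoe : ((iotaPunct p hp hpe ^ (i + 1) : ↥(punct p) ≃ₜ ↥(punct p)) : C(↥(punct p), ↥(punct p))) =
          ((iotaPunct p hp hpe ^ i : ↥(punct p) ≃ₜ ↥(punct p)) : C(↥(punct p), ↥(punct p))).comp
            (iotaPunct p hp hpe : C(↥(punct p), ↥(punct p))) := by
        ext x; rw [pow_succ]; rfl
      rw [hcoe, singularCohomology.map_comp, ModuleCat.comp_apply, ih, h]

/-- **Naturality of the descended maps**: for a homeomorphism `s` of `F°` commuting with `ι` and its descent `s̄ = OrbitSpace.map s`,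
`q^* (s̄^* a) = s^* (q^* a)`. [cite: HatcherAT2002, §3.G Prop. 3G.1] -/
theorem map_proj_map_orbitMap (s : ↥(punct p) ≃ₜ ↥(punct p)) (hs : Commute s (iotaPunct p hp hpe)) (k : ℕ)
    (a : singularCohomology ℚ ℚ (OrbitSpace (iotaPunct p hp hpe)) k) :
    singularCohomology.map ℚ ℚ (OrbitSpace.proj (iotaPunct p hp hpe)) k
        (singularCohomology.map ℚ ℚ (OrbitSpace.map s hs : C(OrbitSpace (iotaPunct p hp hpe), OrbitSpace (iotaPunct p hp hpe))) k a) =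
      singularCohomology.map ℚ ℚ (s : C(↥(punct p), ↥(punct p))) k
        (singularCohomology.map ℚ ℚ (OrbitSpace.proj (iotaPunct p hp hpe)) k a) := by
  rw [← ModuleCat.comp_apply, ← singularCohomology.map_comp, OrbitSpace.map_comp_proj, singularCohomology.map_comp,
    ModuleCat.comp_apply]

/-- A `q^*`-class is `ι^*`-invariant. [cite: HatcherAT2002, §3.G Prop. 3G.1] -/
theorem map_iotaPunct_map_proj (k : ℕ) (a : singularCohomology ℚ ℚ (OrbitSpace (iotaPunct p hp hpe)) k) :
    singularCohomology.map ℚ ℚ (iotaPunct p hp hpe : C(↥(punct p), ↥(punct p))) k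
        (singularCohomology.map ℚ ℚ (OrbitSpace.proj (iotaPunct p hp hpe)) k a) =
      singularCohomology.map ℚ ℚ (OrbitSpace.proj (iotaPunct p hp hpe)) k a :=
  (mem_range_map_proj_iff_rat p hp hpe k _).1 ⟨a, rfl⟩

end Quotient

/-! ### §3 The local piece for `p = 4`, modulo the puncture isomorphism -/

section Four

variable {ζ : ℂ} (hζ : IsPrimitiveRoot ζ 4)

attribute [local instance] OrbitSpace.homeoMulAction

/-- The inclusion `F° ↪ F`. [cite: Milnor1968, §9 Thm. 9.1] -/
def punctIncl (p : ℕ) : C(↥(punct p), fibre (cyclicNodeExponents p)) := ⟨Subtype.val, continuous_subtype_val⟩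

/-- Restriction to `F°` intertwines `ι`. [cite: CarlsonToledo1999, §6 (held text p0013–p0014)] -/
theorem map_punctIncl_map_iotaFibre (p : ℕ) (hp : p ≠ 0) (hpe : Even p) (k : ℕ)
    (x : singularCohomology ℚ ℚ (fibre (cyclicNodeExponents p)) k) :
    singularCohomology.map ℚ ℚ (punctIncl p) k
        (singularCohomology.map ℚ ℚ (iotaFibre p hp hpe : C(fibre (cyclicNodeExponents p), fibre (cyclicNodeExponents p))) k x) =
      singularCohomology.map ℚ ℚ (iotaPunct p hp hpe : C(↥(punct p), ↥(punct p))) k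
        (singularCohomology.map ℚ ℚ (punctIncl p) k x) := by
  have hc : (iotaFibre p hp hpe : C(fibre (cyclicNodeExponents p), fibre (cyclicNodeExponents p))).comp (punctIncl p) =
      (punctIncl p).comp (iotaPunct p hp hpe : C(↥(punct p), ↥(punct p))) := by
    ext z; rfl
  rw [← ModuleCat.comp_apply, ← singularCohomology.map_comp, hc, singularCohomology.map_comp, ModuleCat.comp_apply]

/-- Restriction to `F°` intertwines any homeomorphism of `F` preserving `F°` with its restriction. [cite: Milnor1968, §9 Thm. 9.1] -/
theorem map_punctIncl_map_of_restrict (p : ℕ) (f : C(fibre (cyclicNodeExponents p), fibre (cyclicNodeExponents p)))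
    (g : C(↥(punct p), ↥(punct p))) (hfg : ∀ z : ↥(punct p), ((g z : ↥(punct p)) : fibre (cyclicNodeExponents p)) = f z) (k : ℕ)
    (x : singularCohomology ℚ ℚ (fibre (cyclicNodeExponents p)) k) :
    singularCohomology.map ℚ ℚ (punctIncl p) k (singularCohomology.map ℚ ℚ f k x) =
      singularCohomology.map ℚ ℚ g k (singularCohomology.map ℚ ℚ (punctIncl p) k x) := by
  have hc : f.comp (punctIncl p) = (punctIncl p).comp g :=
    ContinuousMap.ext fun z => (hfg z).symm
  rw [← ModuleCat.comp_apply, ← singularCohomology.map_comp, hc, singularCohomology.map_comp, ModuleCat.comp_apply]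

/-- **The local piece `F°∕ι` for `p = 4`: rank, `τ̄^*² = −1`, and the descended model monodromy acts as `τ̄^*` on `H²(F°∕ι; ℚ)`**,
GIVEN the puncture isomorphism (the restriction `H²(F; ℚ) → H²(F°; ℚ)` bijective — brick L6-5b; removing two points from the
smooth 4-manifold `F` does not change `H²`). With `τ̄ := OrbitSpace.map σ_ζ`, `h̄ := OrbitSpace.map (negPair ∘ σ_ζ)`:
`dim_ℚ H²(F°∕ι; ℚ) = 2`, `(τ̄^*)² = −1`, `h̄^* = τ̄^*`. [cite: HatcherAT2002, §3.G Prop. 3G.1] [cite: Milnor1968, §9 Thm. 9.1 and p. 77]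
[cite: CarlsonToledo1999, §6 (kdoublept) (held text p0013–p0014)] -/
theorem quotientPiece_package
    (hres : Function.Bijective (singularCohomology.map ℚ ℚ (punctIncl 4) 2)) :
    Module.finrank ℚ (singularCohomology ℚ ℚ (OrbitSpace (iotaPunct 4 four_ne_zero (by decide))) 2) = 2 ∧
    (∀ a : singularCohomology ℚ ℚ (OrbitSpace (iotaPunct 4 four_ne_zero (by decide))) 2,
      singularCohomology.map ℚ ℚ
          (OrbitSpace.map (rotatePunct 4 four_ne_zero ⟨ζ, hζ.pow_eq_one⟩)
            (commute_rotatePunct_iotaPunct 4 four_ne_zero (by decide) ⟨ζ, hζ.pow_eq_one⟩) :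
            C(OrbitSpace (iotaPunct 4 four_ne_zero (by decide)), OrbitSpace (iotaPunct 4 four_ne_zero (by decide)))) 2
        (singularCohomology.map ℚ ℚ
          (OrbitSpace.map (rotatePunct 4 four_ne_zero ⟨ζ, hζ.pow_eq_one⟩)
            (commute_rotatePunct_iotaPunct 4 four_ne_zero (by decide) ⟨ζ, hζ.pow_eq_one⟩) :
            C(OrbitSpace (iotaPunct 4 four_ne_zero (by decide)), OrbitSpace (iotaPunct 4 four_ne_zero (by decide)))) 2 a) = -a) ∧
    (∀ a : singularCohomology ℚ ℚ (OrbitSpace (iotaPunct 4 four_ne_zero (by decide))) 2,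
      singularCohomology.map ℚ ℚ
          (OrbitSpace.map (negPairPunct 4 * rotatePunct 4 four_ne_zero ⟨ζ, hζ.pow_eq_one⟩)
            (commute_modelPunct_iotaPunct 4 four_ne_zero (by decide) ⟨ζ, hζ.pow_eq_one⟩) :
            C(OrbitSpace (iotaPunct 4 four_ne_zero (by decide)), OrbitSpace (iotaPunct 4 four_ne_zero (by decide)))) 2 a =
      singularCohomology.map ℚ ℚ
          (OrbitSpace.map (rotatePunct 4 four_ne_zero ⟨ζ, hζ.pow_eq_one⟩)
            (commute_rotatePunct_iotaPunct 4 four_ne_zero (by decide) ⟨ζ, hζ.pow_eq_one⟩) :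
            C(OrbitSpace (iotaPunct 4 four_ne_zero (by decide)), OrbitSpace (iotaPunct 4 four_ne_zero (by decide)))) 2 a) := by
  -- ### notation
  set ι := iotaPunct 4 four_ne_zero (by decide) with hι
  set q := OrbitSpace.proj ι with hq
  set res := singularCohomology.map ℚ ℚ (punctIncl 4) 2 with hres_def
  set τF := (singularCohomology.map ℚ ℚ (rotateFibre (cyclicNodeExponents 4) (cyclicNodeExponents_ne_zero 4 four_ne_zero)
    ⟨ζ, hζ.pow_eq_one⟩ : C(fibre (cyclicNodeExponents 4), fibre (cyclicNodeExponents 4))) 2) with hτF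
  set τP := rotatePunct 4 four_ne_zero ⟨ζ, hζ.pow_eq_one⟩ with hτP
  let E : singularCohomology ℚ ℚ (fibre (cyclicNodeExponents 4)) 2 ≃ₗ[ℚ] singularCohomology ℚ ℚ ↥(punct 4) 2 :=
    LinearEquiv.ofBijective res.hom hres
  have hE : ∀ x, E x = res x := fun x => rfl
  -- `ψ := E⁻¹ ∘ q^*`
  let ψ : singularCohomology ℚ ℚ (OrbitSpace ι) 2 →ₗ[ℚ] singularCohomology ℚ ℚ (fibre (cyclicNodeExponents 4)) 2 :=
    E.symm.toLinearMap ∘ₗ (singularCohomology.map ℚ ℚ q 2).hom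
  have hψ : ∀ a, res (ψ a) = singularCohomology.map ℚ ℚ q 2 a := fun a => by
    change E (E.symm _) = _; rw [LinearEquiv.apply_symm_apply]
  have hψinj : Function.Injective ψ := fun a b hab => by
    apply map_proj_injective_rat 4 four_ne_zero (by decide) 2
    change singularCohomology.map ℚ ℚ q 2 a = singularCohomology.map ℚ ℚ q 2 b
    rw [← hψ, ← hψ, hab]
  -- `ψ a` is `ι_F^*`-invariant, i.e. lies in `ker((τ_F^*)² + 1)`
  have hψι : ∀ a, singularCohomology.map ℚ ℚ (iotaFibre 4 four_ne_zero (by decide) :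
      C(fibre (cyclicNodeExponents 4), fibre (cyclicNodeExponents 4))) 2 (ψ a) = ψ a := fun a => by
    apply hres.1
    rw [hres_def, map_punctIncl_map_iotaFibre, ← hres_def, hψ, map_iotaPunct_map_proj]
  have hψker : ∀ a, ψ a ∈ LinearMap.ker (cohomologyTauFour ℚ hζ ^ 2 + 1) := fun a => by
    rw [LinearMap.mem_ker, LinearMap.add_apply, Module.End.one_apply]
    have h := (cohomologyMap_iotaFibre_eq_self_iff ℚ hζ (ψ a)).1 (hψι a)
    rw [h, neg_add_cancel]
  -- the range of `ψ` IS `ker((τ_F^*)² + 1)`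
  have hrange : LinearMap.range ψ = LinearMap.ker (cohomologyTauFour ℚ hζ ^ 2 + 1) := by
    apply le_antisymm
    · rintro _ ⟨a, rfl⟩; exact hψker a
    · intro x hx
      have hfix : singularCohomology.map ℚ ℚ (iotaFibre 4 four_ne_zero (by decide) :
          C(fibre (cyclicNodeExponents 4), fibre (cyclicNodeExponents 4))) 2 x = x := by
        rw [LinearMap.mem_ker, LinearMap.add_apply, Module.End.one_apply] at hx
        exact (cohomologyMap_iotaFibre_eq_self_iff ℚ hζ x).2 (eq_neg_of_add_eq_zero_left hx)
      have hinv : singularCohomology.map ℚ ℚ (ι : C(↥(punct 4), ↥(punct 4))) 2 (res x) = res x := by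
        rw [hres_def, hι, ← map_punctIncl_map_iotaFibre, hfix]
      obtain ⟨a, ha⟩ := (mem_range_map_proj_iff_rat 4 four_ne_zero (by decide) 2 (res x)).2 hinv
      refine ⟨a, hres.1 ?_⟩
      rw [hψ, ← ha]
  -- naturality of `ψ` with the covering rotation
  have hresτ : ∀ x, res (τF x) = singularCohomology.map ℚ ℚ (τP : C(↥(punct 4), ↥(punct 4))) 2 (res x) := fun x =>
    map_punctIncl_map_of_restrict 4 _ _ (fun z => rfl) 2 x
  have hψτ : ∀ a, ψ (singularCohomology.map ℚ ℚ (OrbitSpace.map τP (commute_rotatePunct_iotaPunct 4 four_ne_zero (by decide)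
      ⟨ζ, hζ.pow_eq_one⟩) : C(OrbitSpace ι, OrbitSpace ι)) 2 a) = τF (ψ a) := fun a => by
    apply hres.1
    rw [hψ, hresτ, hψ]
    exact map_proj_map_orbitMap 4 four_ne_zero (by decide) τP _ 2 a
  refine ⟨?_, ?_, ?_⟩
  -- ### rank 2
  · rw [← LinearMap.finrank_range_of_inj hψinj, hrange]
    exact finrank_ker_cohomologyTauFour_sq_add_one_eq_two hζ
  -- ### `(τ̄^*)² = −1`
  · intro a
    apply hψinj
    rw [hψτ, hψτ, map_neg]
    have h := hψker a
    rw [LinearMap.mem_ker, LinearMap.add_apply, Module.End.one_apply, pow_two, Module.End.mul_apply] at h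
    exact eq_neg_of_add_eq_zero_left h
  -- ### the descended model monodromy acts as `τ̄^*`
  · intro a
    apply hψinj
    rw [hψτ]
    -- `ψ (h̄^* a) = h_F^* (ψ a)` and `h_F^* = τ_F^*` on `H²(F; ℚ)`
    set hF : C(fibre (cyclicNodeExponents 4), fibre (cyclicNodeExponents 4)) :=
      (negPairFibre (cyclicNodeExponents 4) (i := 0) (j := 1) (by decide) rfl rfl :
          C(fibre (cyclicNodeExponents 4), fibre (cyclicNodeExponents 4))).comp
        (rotateFibre (cyclicNodeExponents 4) (cyclicNodeExponents_ne_zero 4 four_ne_zero) ⟨ζ, hζ.pow_eq_one⟩ :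
          C(fibre (cyclicNodeExponents 4), fibre (cyclicNodeExponents 4))) with hhF
    have hresH : ∀ x, res (singularCohomology.map ℚ ℚ hF 2 x) =
        singularCohomology.map ℚ ℚ ((negPairPunct 4 * τP : ↥(punct 4) ≃ₜ ↥(punct 4)) : C(↥(punct 4), ↥(punct 4))) 2 (res x) :=
      fun x => map_punctIncl_map_of_restrict 4 _ _ (fun z => rfl) 2 x
    have hψh : ψ (singularCohomology.map ℚ ℚ (OrbitSpace.map (negPairPunct 4 * τP)
        (commute_modelPunct_iotaPunct 4 four_ne_zero (by decide) ⟨ζ, hζ.pow_eq_one⟩) : C(OrbitSpace ι, OrbitSpace ι)) 2 a) =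
        singularCohomology.map ℚ ℚ hF 2 (ψ a) := by
      apply hres.1
      rw [hψ, hresH, hψ]
      exact map_proj_map_orbitMap 4 four_ne_zero (by decide) _ _ 2 a
    rw [hψh]
    -- `h_F^* = τ_F^*` (Kronecker transfer of `map_modelMonodromy_eq_map_rotateFibre`)
    have hmodel := cohomologyMap_pow_eq_smul_pow_of_homology ℚ
      (rotateFibre (cyclicNodeExponents 4) (cyclicNodeExponents_ne_zero 4 four_ne_zero) ⟨ζ, hζ.pow_eq_one⟩ :
        C(fibre (cyclicNodeExponents 4), fibre (cyclicNodeExponents 4))) hF 2 1 1 1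
      (fun z => by
        rw [pow_one, pow_one, one_smul, hhF]
        exact congrArg (fun f => f z) (congrArg ModuleCat.Hom.hom
          (map_modelMonodromy_eq_map_rotateFibre 4 ℚ four_ne_zero ⟨ζ, hζ.pow_eq_one⟩ 2))) (ψ a)
    rw [pow_one, pow_one, one_smul] at hmodel
    exact hmodel

end Four

end PhamBrieskorn

end Literature.Geometry.ComplexAnalytic

end
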